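import Summits.Ventures.LatticeQCDFlow.Scoring.ChainScorerTauIntStudentisedCLT
import Summits.Ventures.LatticeQCDFlow.Scoring.ChainScorerDataWindowCLT

/-!
# AT THE SCORER'S OWN WINDOW: the fully empirical studentised error bar of scorer A's `τ_int`, with
# window, estimate, gradient and variance matrix ALL read at the data-chosen Madras–Sokal window, has
# asymptotically EXACT coverage on Markov-chain data, from EVERY initial law

HONEST FRAMING: exact (Metropolis-corrected) sampling algorithms for lattice gauge theory;
figures of merit are autocorrelation/cost numbers at stated couplings and volumes; no
continuum-physics claim.

Venture `LatticeQCDFlow` (cell pub-lqcd), sub-topic `Scoring`; FANOUT row 16 (`su2-base`), GEN-10.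
NEW WORK of the cell, not a published result; no definition; nothing is cited as a fact.  DOCKING of
GEN-10's fully empirical studentised coverage at a FIXED window
(`Scoring/ChainScorerTauIntStudentisedCLT.tendsto_measure_chain_scorer_studentized_tauIntWindow_le_of_nHit`)
with GEN-8's data-chosen-window transfer for coverage-type statements
(`Scoring/MadrasSokalDataWindow.tendsto_measure_at_msWindow`: an event family whose window-`w` member has a
limiting probability keeps it when read at a selector that is eventually `w`) and GEN-9's consistency of
scorer A's `τ̂_N(W)` along the chain (`Scoring/ChainScorerDataWindowCLT`).  The last NOT-CLAIMED line of
`ChainScorerTauIntStudentisedCLT` ('the data-chosen window composed with the studentised bar').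

## Content (`κ` Markov, `π` invariant, `(nHit κ m)(z,·) ≥ ε ν` for all `z`, `ε ≠ 0`, `0 < m`; `|f| ≤ C`
## measurable, `f̄ = f − ∫ f dπ`, `C(t) = autocov κ π f̄ t`, `C(0) ≠ 0`; `τ_W = tauIntWindow (C/C(0)) W`;
## `c > 0`, `w` a STRICT Madras–Sokal window of `W ↦ τ_W` with `σ²_ℓ(w) > 0`; `Ŵ_N` a measurable-free
## admissible selector (returns `w` whenever `w` is the MS window of scorer A's empirical curve); `K_N → ∞`,
## `K_N³/N → 0`; `σ̂²_{A,N}(W)` the fully empirical variance statistic of `ChainTauIntEmpiricalVariance` at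
## window `W`; `μ₀` ANY initial law)

* **`chain_tendsto_measure_scorer_studentizedBar_at_msWindow_of_nHit`** — for every `z > 0`:
  `P_{μ₀}{|√N (τ̂^A_N(Ŵ_N) − τ_{Ŵ_N}) · (√σ̂²_{A,N}(Ŵ_N))⁻¹| ≤ z} → gaussianReal 0 1 (Icc (−z) z)`.

NOT CLAIMED: tangential crossings (the selector then has a mixture law, GEN-8 `MadrasSokalTangentialWindow`);
`σ²_ℓ(w) > 0` for a given sampler; rates; any number about row 16's chains.
-/

noncomputable section

open MeasureTheory ProbabilityTheory Filter Finset Preorder WithLp Set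
open scoped ENNReal NNReal Topology RealInnerProductSpace
open Summit.Ventures.LatticeQCDFlow.Exactness Summit.Ventures.LatticeQCDFlow.Exactness.GeneralNCMC

namespace Summit.Ventures.LatticeQCDFlow.Scoring

variable {S : Type*} [MeasurableSpace S]

section AtWindow

variable (κ : Kernel S S) [IsMarkovKernel κ] {π : Measure S} [IsProbabilityMeasure π]
  {ν : Measure S} [IsProbabilityMeasure ν] {ε : ℝ≥0∞} {m : ℕ}

/-- **THE FULLY EMPIRICAL STUDENTISED BAR AT THE SCORER'S OWN WINDOW HAS ASYMPTOTICALLY EXACT COVERAGE,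
ON CHAIN DATA, FROM EVERY INITIAL LAW.**  Strict population Madras–Sokal window `w` at `c > 0`,
admissible selector `Ŵ_N`, `C(0) ≠ 0`, `σ²_ℓ(w) > 0`, truncations `K_N → ∞`, `K_N³/N → 0`.  For every
`z > 0`, the probability that `τ_{Ŵ_N}` lies within `z` studentised bars `σ̂_{A,N}(Ŵ_N)/√N` of scorer A's
`τ̂_N(Ŵ_N)` — window, estimate, gradient and variance matrix all read at the data-chosen window — tends to
`gaussianReal 0 1 (Icc (−z) z)`. -/
theorem chain_tendsto_measure_scorer_studentizedBar_at_msWindow_of_nHit (hπ : Kernel.Invariant κ π)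
    (hε : ε ≠ 0) (hmin : ∀ z, ε • ν ≤ nHit κ m z) (hm : 0 < m)
    {f : S → ℝ} (hf : Measurable f) {C : ℝ} (hC : ∀ z, |f z| ≤ C)
    (hσ : autocov κ π (fun z => f z - ∫ z', f z' ∂π) 0 ≠ 0) {c : ℝ} (hc : 0 < c) {w : ℕ}
    (hw : IsStrictMSWindow c (fun W => tauIntWindow (fun t =>
      autocov κ π (fun z => f z - ∫ z', f z' ∂π) t / autocov κ π (fun z => f z - ∫ z', f z' ∂π) 0) W) w)
    (hpos : 0 < ∑ s : Fin (w + 1), ∑ t : Fin (w + 1),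
        tauHatGrad w (toLp 2 fun u : Fin (w + 1) => autocov κ π (fun z => f z - ∫ z', f z' ∂π) u) s
          * tauHatGrad w (toLp 2 fun u : Fin (w + 1) => autocov κ π (fun z => f z - ∫ z', f z' ∂π) u) t
          * chainLagACov κ π (fun z => f z - ∫ z', f z' ∂π) w s t)
    {K : ℕ → ℕ} (hK : Tendsto K atTop atTop) (hK3 : Tendsto (fun N => (K N : ℝ) ^ 3 / N) atTop (𝓝 0))
    {Wsel : ℕ → (ℕ → S) → ℕ}
    (hsel : ∀ N x, IsMSWindow c (fun W => tauIntWindow (rhoHat (fun i => f (x i)) N) W) w → Wsel N x = w)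
    (μ₀ : Measure S) [IsProbabilityMeasure μ₀] {z : ℝ} (hz : 0 < z)
    [IsProbabilityMeasure (Kernel.trajMeasure (X := fun _ : ℕ => S) μ₀
        (fun n : ℕ => κ.comap (fun hh : (i : ↥(Finset.Iic n)) → S => hh ⟨n, Finset.mem_Iic.2 le_rfl⟩)
          (measurable_pi_apply _)))] :
    Tendsto (fun N : ℕ => (Kernel.trajMeasure (X := fun _ : ℕ => S) μ₀
        (fun n : ℕ => κ.comap (fun hh : (i : ↥(Finset.Iic n)) → S => hh ⟨n, Finset.mem_Iic.2 le_rfl⟩)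
          (measurable_pi_apply _)))
        {x : ℕ → S | |Real.sqrt N
          * (tauIntWindow (rhoHat (fun i => f (x i)) N) (Wsel N x)
            - tauIntWindow (fun t => autocov κ π (fun z => f z - ∫ z', f z' ∂π) t
                / autocov κ π (fun z => f z - ∫ z', f z' ∂π) 0) (Wsel N x))
          * (Real.sqrt (∑ s : Fin (Wsel N x + 1), ∑ t : Fin (Wsel N x + 1),
            tauHatGrad (Wsel N x) (toLp 2 fun u : Fin (Wsel N x + 1) => gammaHat (fun j => f (x j)) N u) s
              * tauHatGrad (Wsel N x) (toLp 2 fun u : Fin (Wsel N x + 1) =>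
                  gammaHat (fun j => f (x j)) N u) t
              * gammaCross
                  (fun i => (f (x i) - sampleMean (fun j => f (x j)) N)
                    * (f (x (i + s)) - sampleMean (fun j => f (x j)) N))
                  (fun i => (f (x i) - sampleMean (fun j => f (x j)) N)
                    * (f (x (i + t)) - sampleMean (fun j => f (x j)) N)) N (K N)))⁻¹| ≤ z})
      atTop (𝓝 (gaussianReal 0 1 (Icc (-z) z))) :=
  tendsto_measure_at_msWindow
    (A := fun (N W : ℕ) => {x : ℕ → S | |Real.sqrt N
        * (tauIntWindow (rhoHat (fun i => f (x i)) N) W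
          - tauIntWindow (fun t => autocov κ π (fun z => f z - ∫ z', f z' ∂π) t
              / autocov κ π (fun z => f z - ∫ z', f z' ∂π) 0) W)
        * (Real.sqrt (∑ s : Fin (W + 1), ∑ t : Fin (W + 1),
          tauHatGrad W (toLp 2 fun u : Fin (W + 1) => gammaHat (fun j => f (x j)) N u) s
            * tauHatGrad W (toLp 2 fun u : Fin (W + 1) => gammaHat (fun j => f (x j)) N u) t
            * gammaCross
                (fun i => (f (x i) - sampleMean (fun j => f (x j)) N)
                  * (f (x (i + s)) - sampleMean (fun j => f (x j)) N))
                (fun i => (f (x i) - sampleMean (fun j => f (x j)) N)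
                  * (f (x (i + t)) - sampleMean (fun j => f (x j)) N)) N (K N)))⁻¹| ≤ z})
    (τhat := fun (N W : ℕ) (x : ℕ → S) => tauIntWindow (rhoHat (fun i => f (x i)) N) W)
    (tendsto_measure_chain_scorer_studentized_tauIntWindow_le_of_nHit κ w hπ hε hmin hm hf hC hσ hpos hK
      hK3 μ₀ hz) hc hw
    (fun W _ _ => chain_scorer_tauIntWindow_tendstoInMeasure_of_nHit κ hπ hε hmin hm hf hC hσ μ₀ W) hsel

end AtWindow

end Summit.Ventures.LatticeQCDFlow.Scoring

end
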